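import Summits.QuantumFields.YangMills.Theorems.SourcedPressureJensenSourcedPressureIncrementGaussWickSquares
import Summits.QuantumFields.YangMills.Theorems.SourcedPressureJensenSourcedPressureIncrementGaussFirstCumulant
import HarnessLib

/-!
# `SourcedPressureIncrement` (stmt-QuantumFields-22517), line `birth`: the COVARIANCE of two site terms of the Gaussian source
# (engine file 2/3 toward the second `h`-cumulant of `gaussIncrement`, `stub_gauss` / cold-box item stmt-QuantumFields-23807)

Continues `…GaussWickSquares` (file 1/3).  §1 (any centred Gaussian process): the covariance of two products of Wick squares,
`E[(W_aW_b − 2S_ab²)(W_cW_e − 2S_ce²)] = 4S_ac²S_be² + 4S_ae²S_bc² + 16S_acS_aeS_bcS_be + 16S_abS_ce(S_acS_be + S_aeS_bc)`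
(`integral_centred_wickSq2_mul`; every surviving pairing joins `{a,b}` to `{c,e}` by AT LEAST TWO lines), integrability
companions, and the monotone bound `abs_covForm_le` / `covForm_mono`.  §2 (`γ = curvatureGaussianField d D`):
`E_γ[Y_p^aY_q^b] = δ_ab C(p,q)` and the colour-sum form `(λ/2)|Y_p|² − (λ/2)D C(p,p) = (λ/2)Σ_a W_{(p,a)}`.  §3 (`d = 4`, the summand
of `gaussIncrement` VERBATIM, `X_x = A_xA_{x+ne₀}`, mean `(λ²D/2)C(n)²` from `gauss_firstCumulant`): **`abs_gauss_cov_le`** —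
`|E_γ[(X_x − EX_x)(X_y − EX_y)]| ≤ (λ/2)⁴D⁴·Φ(x,y,n)`,
`Φ = 4C_{xy}²C_{x'y'}² + 4C_{xy'}²C_{x'y}² + 16|C_{xy}C_{xy'}C_{x'y}C_{x'y'}| + 16|C_{xx'}C_{yy'}|(|C_{xy}C_{x'y'}| + |C_{xy'}C_{x'y}|)`,
`C_{uv} = curvatureTwoPoint (p₁₂u) (p₁₂v)`, `x' = x + ne₀`, `y' = y + ne₀` (colour by colour, `|δ_ab C| ≤ |C|`).  File 3/3 sums `Φ`
over `y` with the decay of `CurvatureDecay`.  RECORD-label rung support (all-`G` leaf `WeakCouplingRates.XiPow`); the Yang–Mills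
mass gap is NOT proved by anything here.  Source: S. Janson, *Gaussian Hilbert Spaces* (1997) Thm 1.28. [folklore]
-/

noncomputable section

open MeasureTheory ProbabilityTheory Literature.Probability.Distributions

namespace Summit.QuantumFields.YangMills.Cruxes.SourcedPressureIncrement.Birth

/-! ### §1 The covariance of two products of Wick squares (any centred Gaussian process) -/

section WickSquares

variable {T Ω : Type*} {mΩ : MeasurableSpace Ω} {P : Measure Ω} {X : T → Ω → ℝ}

/-- **The covariance of two products of Wick squares**: with `W_t = X_t² − S_tt` and `E[W_sW_t] = 2S_st²`,
`E[(W_aW_b − 2S_ab²)(W_cW_e − 2S_ce²)] = 4S_ac²S_be² + 4S_ae²S_bc² + 16S_acS_aeS_bcS_be + 16S_abS_ce(S_acS_be + S_aeS_bc)`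
— every surviving pairing joins the group `{a, b}` to the group `{c, e}` by at least two lines. [cite: Janson1997, Thm 1.28] -/
theorem integral_centred_wickSq2_mul (hX : IsGaussianProcess X P) (h0 : ∀ t, ∫ ω, X t ω ∂P = 0) (a b c e : T) :
    ∫ ω, ((X a ω * X a ω - ∫ ω', X a ω' * X a ω' ∂P) * (X b ω * X b ω - ∫ ω', X b ω' * X b ω' ∂P) -
          2 * (∫ ω', X a ω' * X b ω' ∂P) ^ 2) *
        ((X c ω * X c ω - ∫ ω', X c ω' * X c ω' ∂P) * (X e ω * X e ω - ∫ ω', X e ω' * X e ω' ∂P) -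
          2 * (∫ ω', X c ω' * X e ω' ∂P) ^ 2) ∂P =
      4 * ((∫ ω, X a ω * X c ω ∂P) ^ 2 * (∫ ω, X b ω * X e ω ∂P) ^ 2) +
      4 * ((∫ ω, X a ω * X e ω ∂P) ^ 2 * (∫ ω, X b ω * X c ω ∂P) ^ 2) +
      16 * ((∫ ω, X a ω * X c ω ∂P) * (∫ ω, X a ω * X e ω ∂P) * (∫ ω, X b ω * X c ω ∂P) *
        (∫ ω, X b ω * X e ω ∂P)) +
      16 * ((∫ ω, X a ω * X b ω ∂P) * (∫ ω, X c ω * X e ω ∂P)) *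
        ((∫ ω, X a ω * X c ω ∂P) * (∫ ω, X b ω * X e ω ∂P) + (∫ ω, X a ω * X e ω ∂P) * (∫ ω, X b ω * X c ω ∂P)) := by
  have := hX.isProbabilityMeasure
  set Saa : ℝ := ∫ ω', X a ω' * X a ω' ∂P with hSaa
  set Sbb : ℝ := ∫ ω', X b ω' * X b ω' ∂P with hSbb
  set Scc : ℝ := ∫ ω', X c ω' * X c ω' ∂P with hScc
  set See : ℝ := ∫ ω', X e ω' * X e ω' ∂P with hSee
  set Sab : ℝ := ∫ ω', X a ω' * X b ω' ∂P with hSab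
  set Sce : ℝ := ∫ ω', X c ω' * X e ω' ∂P with hSce
  set Fab : Ω → ℝ := fun ω => (X a ω * X a ω - Saa) * (X b ω * X b ω - Sbb) with hFab
  set Fce : Ω → ℝ := fun ω => (X c ω * X c ω - Scc) * (X e ω * X e ω - See) with hFce
  have hI : ∀ q : MvPolynomial (Fin 4) ℝ, Integrable (fun ω => MvPolynomial.eval (fun i => X (![a, b, c, e] i) ω) q) P :=
    fun q => integrable_mvPolynomial_eval hX ![a, b, c, e] q
  have h4 : ∫ ω, Fab ω * Fce ω ∂P = 4 * (Sab ^ 2 * Sce ^ 2) +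
      4 * ((∫ ω, X a ω * X c ω ∂P) ^ 2 * (∫ ω, X b ω * X e ω ∂P) ^ 2) +
      4 * ((∫ ω, X a ω * X e ω ∂P) ^ 2 * (∫ ω, X b ω * X c ω ∂P) ^ 2) +
      16 * ((∫ ω, X a ω * X c ω ∂P) * (∫ ω, X a ω * X e ω ∂P) * (∫ ω, X b ω * X c ω ∂P) *
        (∫ ω, X b ω * X e ω ∂P)) +
      16 * (Sab * Sce) *
        ((∫ ω, X a ω * X c ω ∂P) * (∫ ω, X b ω * X e ω ∂P) + (∫ ω, X a ω * X e ω ∂P) * (∫ ω, X b ω * X c ω ∂P)) :=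
    integral_wickSq_four hX h0 a b c e
  have hab : ∫ ω, Fab ω ∂P = 2 * Sab ^ 2 := integral_wickSq_mul_wickSq hX h0 a b
  have hce : ∫ ω, Fce ω ∂P = 2 * Sce ^ 2 := integral_wickSq_mul_wickSq hX h0 c e
  have iab : Integrable Fab P :=
    (hI ((MvPolynomial.X 0 * MvPolynomial.X 0 - MvPolynomial.C Saa) *
        (MvPolynomial.X 1 * MvPolynomial.X 1 - MvPolynomial.C Sbb))).congr
      (ae_of_all _ fun ω => by simp [hFab])
  have ice : Integrable Fce P :=
    (hI ((MvPolynomial.X 2 * MvPolynomial.X 2 - MvPolynomial.C Scc) *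
        (MvPolynomial.X 3 * MvPolynomial.X 3 - MvPolynomial.C See))).congr
      (ae_of_all _ fun ω => by simp [hFce])
  have i4 : Integrable (fun ω => Fab ω * Fce ω) P :=
    (hI (((MvPolynomial.X 0 * MvPolynomial.X 0 - MvPolynomial.C Saa) *
        (MvPolynomial.X 1 * MvPolynomial.X 1 - MvPolynomial.C Sbb)) *
        ((MvPolynomial.X 2 * MvPolynomial.X 2 - MvPolynomial.C Scc) *
          (MvPolynomial.X 3 * MvPolynomial.X 3 - MvPolynomial.C See)))).congr
      (ae_of_all _ fun ω => by simp [hFab, hFce])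
  have e0 : (fun ω => (Fab ω - 2 * Sab ^ 2) * (Fce ω - 2 * Sce ^ 2)) =
      fun ω => (Fab ω * Fce ω - 2 * Sce ^ 2 * Fab ω) - (2 * Sab ^ 2 * Fce ω - 2 * Sab ^ 2 * (2 * Sce ^ 2)) := by
    funext ω; ring
  have i12 : Integrable (fun ω => Fab ω * Fce ω - 2 * Sce ^ 2 * Fab ω) P := i4.sub (iab.const_mul _)
  have i34 : Integrable (fun ω => 2 * Sab ^ 2 * Fce ω - 2 * Sab ^ 2 * (2 * Sce ^ 2)) P :=
    (ice.const_mul _).sub (integrable_const _)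
  show ∫ ω, (Fab ω - 2 * Sab ^ 2) * (Fce ω - 2 * Sce ^ 2) ∂P = _
  rw [e0, integral_sub i12 i34, integral_sub i4 (iab.const_mul _), integral_sub (ice.const_mul _) (integrable_const _),
    integral_const_mul, integral_const_mul, integral_const, probReal_univ, one_smul, h4, hab, hce]
  ring

/-- Integrability of the centred product of two products of Wick squares (a polynomial in the legs).
[cite: Janson1997, Ch. 1 §3, sentence before Thm 1.28] -/
theorem integrable_centred_wickSq2_mul (hX : IsGaussianProcess X P) (a b c e : T) :
    Integrable (fun ω => ((X a ω * X a ω - ∫ ω', X a ω' * X a ω' ∂P) * (X b ω * X b ω - ∫ ω', X b ω' * X b ω' ∂P) -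
          2 * (∫ ω', X a ω' * X b ω' ∂P) ^ 2) *
        ((X c ω * X c ω - ∫ ω', X c ω' * X c ω' ∂P) * (X e ω * X e ω - ∫ ω', X e ω' * X e ω' ∂P) -
          2 * (∫ ω', X c ω' * X e ω' ∂P) ^ 2)) P :=
  (integrable_mvPolynomial_eval hX ![a, b, c, e]
      (((MvPolynomial.X 0 * MvPolynomial.X 0 - MvPolynomial.C (∫ ω', X a ω' * X a ω' ∂P)) *
          (MvPolynomial.X 1 * MvPolynomial.X 1 - MvPolynomial.C (∫ ω', X b ω' * X b ω' ∂P)) -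
          MvPolynomial.C (2 * (∫ ω', X a ω' * X b ω' ∂P) ^ 2)) *
        ((MvPolynomial.X 2 * MvPolynomial.X 2 - MvPolynomial.C (∫ ω', X c ω' * X c ω' ∂P)) *
          (MvPolynomial.X 3 * MvPolynomial.X 3 - MvPolynomial.C (∫ ω', X e ω' * X e ω' ∂P)) -
          MvPolynomial.C (2 * (∫ ω', X c ω' * X e ω' ∂P) ^ 2)))).congr
    (ae_of_all _ fun ω => by simp)

/-- Integrability of a product of two Wick squares. [cite: Janson1997, Ch. 1 §3, sentence before Thm 1.28] -/
theorem integrable_wickSq_mul_wickSq (hX : IsGaussianProcess X P) (a b : T) :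
    Integrable (fun ω => (X a ω * X a ω - ∫ ω', X a ω' * X a ω' ∂P) * (X b ω * X b ω - ∫ ω', X b ω' * X b ω' ∂P)) P :=
  (integrable_mvPolynomial_eval hX ![a, b]
      ((MvPolynomial.X 0 * MvPolynomial.X 0 - MvPolynomial.C (∫ ω', X a ω' * X a ω' ∂P)) *
        (MvPolynomial.X 1 * MvPolynomial.X 1 - MvPolynomial.C (∫ ω', X b ω' * X b ω' ∂P)))).congr
    (ae_of_all _ fun ω => by simp)

/-- Integrability of a product of four Wick squares. [cite: Janson1997, Ch. 1 §3, sentence before Thm 1.28] -/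
theorem integrable_wickSq_four (hX : IsGaussianProcess X P) (a b c e : T) :
    Integrable (fun ω => (X a ω * X a ω - ∫ ω', X a ω' * X a ω' ∂P) * (X b ω * X b ω - ∫ ω', X b ω' * X b ω' ∂P) *
      ((X c ω * X c ω - ∫ ω', X c ω' * X c ω' ∂P) * (X e ω * X e ω - ∫ ω', X e ω' * X e ω' ∂P))) P :=
  (integrable_mvPolynomial_eval hX ![a, b, c, e]
      ((MvPolynomial.X 0 * MvPolynomial.X 0 - MvPolynomial.C (∫ ω', X a ω' * X a ω' ∂P)) *
          (MvPolynomial.X 1 * MvPolynomial.X 1 - MvPolynomial.C (∫ ω', X b ω' * X b ω' ∂P)) *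
        ((MvPolynomial.X 2 * MvPolynomial.X 2 - MvPolynomial.C (∫ ω', X c ω' * X c ω' ∂P)) *
          (MvPolynomial.X 3 * MvPolynomial.X 3 - MvPolynomial.C (∫ ω', X e ω' * X e ω' ∂P))))).congr
    (ae_of_all _ fun ω => by simp)

/-- **Monotone bound for the covariance form**: if `|s_ij| ≤ c_ij` then
`|4s₁₃²s₂₄² + 4s₁₄²s₂₃² + 16s₁₃s₁₄s₂₃s₂₄ + 16s₁₂s₃₄(s₁₃s₂₄ + s₁₄s₂₃)| ≤` the same form in the `c_ij` (all coefficients are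
positive). [folklore] -/
theorem abs_covForm_le {s12 s13 s14 s23 s24 s34 c12 c13 c14 c23 c24 c34 : ℝ} (h12 : |s12| ≤ c12) (h13 : |s13| ≤ c13)
    (h14 : |s14| ≤ c14) (h23 : |s23| ≤ c23) (h24 : |s24| ≤ c24) (h34 : |s34| ≤ c34) :
    |4 * (s13 ^ 2 * s24 ^ 2) + 4 * (s14 ^ 2 * s23 ^ 2) + 16 * (s13 * s14 * s23 * s24) +
        16 * (s12 * s34) * (s13 * s24 + s14 * s23)| ≤
      4 * (c13 ^ 2 * c24 ^ 2) + 4 * (c14 ^ 2 * c23 ^ 2) + 16 * (c13 * c14 * c23 * c24) +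
        16 * (c12 * c34) * (c13 * c24 + c14 * c23) := by
  have a13 := abs_nonneg s13; have a14 := abs_nonneg s14
  have a23 := abs_nonneg s23; have a24 := abs_nonneg s24
  have n12 : 0 ≤ c12 := (abs_nonneg s12).trans h12
  have n13 : 0 ≤ c13 := a13.trans h13
  have n14 : 0 ≤ c14 := a14.trans h14
  have n23 : 0 ≤ c23 := a23.trans h23
  have n34 : 0 ≤ c34 := (abs_nonneg s34).trans h34
  have t1 : |4 * (s13 ^ 2 * s24 ^ 2)| ≤ 4 * (c13 ^ 2 * c24 ^ 2) := by
    rw [abs_mul, abs_mul, abs_pow, abs_pow, abs_of_pos (by norm_num : (0:ℝ) < 4)]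
    gcongr
  have t2 : |4 * (s14 ^ 2 * s23 ^ 2)| ≤ 4 * (c14 ^ 2 * c23 ^ 2) := by
    rw [abs_mul, abs_mul, abs_pow, abs_pow, abs_of_pos (by norm_num : (0:ℝ) < 4)]
    gcongr
  have t3 : |16 * (s13 * s14 * s23 * s24)| ≤ 16 * (c13 * c14 * c23 * c24) := by
    rw [abs_mul, abs_mul, abs_mul, abs_mul, abs_of_pos (by norm_num : (0:ℝ) < 16)]
    have : |s13| * |s14| * |s23| * |s24| ≤ c13 * c14 * c23 * c24 := by
      have h1 : |s13| * |s14| ≤ c13 * c14 := mul_le_mul h13 h14 a14 n13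
      have h2 : |s13| * |s14| * |s23| ≤ c13 * c14 * c23 := mul_le_mul h1 h23 a23 (mul_nonneg n13 n14)
      exact mul_le_mul h2 h24 a24 (mul_nonneg (mul_nonneg n13 n14) n23)
    linarith
  have t4 : |16 * (s12 * s34) * (s13 * s24 + s14 * s23)| ≤ 16 * (c12 * c34) * (c13 * c24 + c14 * c23) := by
    rw [abs_mul, abs_mul, abs_mul, abs_of_pos (by norm_num : (0:ℝ) < 16)]
    have h5 : |s13 * s24 + s14 * s23| ≤ c13 * c24 + c14 * c23 := by
      refine (abs_add_le _ _).trans ?_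
      rw [abs_mul, abs_mul]
      exact add_le_add (mul_le_mul h13 h24 a24 n13) (mul_le_mul h14 h23 a23 n14)
    have h6 : |s12| * |s34| ≤ c12 * c34 := mul_le_mul h12 h34 (abs_nonneg _) n12
    have h7 : 0 ≤ |s13 * s24 + s14 * s23| := abs_nonneg _
    calc 16 * (|s12| * |s34|) * |s13 * s24 + s14 * s23| ≤ 16 * (c12 * c34) * |s13 * s24 + s14 * s23| := by
          gcongr
      _ ≤ 16 * (c12 * c34) * (c13 * c24 + c14 * c23) := by gcongr
  have hA := abs_add_le (4 * (s13 ^ 2 * s24 ^ 2) + 4 * (s14 ^ 2 * s23 ^ 2) + 16 * (s13 * s14 * s23 * s24))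
    (16 * (s12 * s34) * (s13 * s24 + s14 * s23))
  have hB := abs_add_le (4 * (s13 ^ 2 * s24 ^ 2) + 4 * (s14 ^ 2 * s23 ^ 2)) (16 * (s13 * s14 * s23 * s24))
  have hC := abs_add_le (4 * (s13 ^ 2 * s24 ^ 2)) (4 * (s14 ^ 2 * s23 ^ 2))
  linarith

/-- Monotonicity of the covariance form in nonnegative arguments. [folklore] -/
theorem covForm_mono {s12 s13 s14 s23 s24 s34 c12 c13 c14 c23 c24 c34 : ℝ} (n12 : 0 ≤ s12) (h12 : s12 ≤ c12)
    (n13 : 0 ≤ s13) (h13 : s13 ≤ c13) (n14 : 0 ≤ s14) (h14 : s14 ≤ c14) (n23 : 0 ≤ s23) (h23 : s23 ≤ c23)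
    (n24 : 0 ≤ s24) (h24 : s24 ≤ c24) (n34 : 0 ≤ s34) (h34 : s34 ≤ c34) :
    4 * (s13 ^ 2 * s24 ^ 2) + 4 * (s14 ^ 2 * s23 ^ 2) + 16 * (s13 * s14 * s23 * s24) +
        16 * (s12 * s34) * (s13 * s24 + s14 * s23) ≤
      4 * (c13 ^ 2 * c24 ^ 2) + 4 * (c14 ^ 2 * c23 ^ 2) + 16 * (c13 * c14 * c23 * c24) +
        16 * (c12 * c34) * (c13 * c24 + c14 * c23) :=
  (le_abs_self _).trans
    (abs_covForm_le ((abs_of_nonneg n12).le.trans h12) ((abs_of_nonneg n13).le.trans h13)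
      ((abs_of_nonneg n14).le.trans h14) ((abs_of_nonneg n23).le.trans h23) ((abs_of_nonneg n24).le.trans h24)
      ((abs_of_nonneg n34).le.trans h34))

end WickSquares

/-! ### §2 The curvature Gaussian field: two-point integrals and the colour-sum form of the centred composite -/

section Curvature

open Literature.MathematicalPhysics.QuantumFieldTheory Literature.MathematicalPhysics.QuantumLattice
open Literature.Probability.LatticeModels

variable {d : ℕ}

/-- `E_γ[Y_p^a Y_q^b] = δ_{ab} · curvatureTwoPoint p q` as a plain integral (the field is centred). [folklore] -/
theorem integral_eval_mul_eval_curvatureGaussianField (hd : 3 ≤ d) (D : ℕ) (p q : ZdPlaquette d) (a b : Fin D) :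
    ∫ Y, Y p a * Y q b ∂curvatureGaussianField d D = if a = b then curvatureTwoPoint p q else 0 := by
  rw [integral_curvatureGaussianField_eq]
  exact Literature.MathematicalPhysics.QuantumFieldTheory.Balaban1983to89.B3WTFreeMeasure.integral_eval_mul
    (isPosSemidefKernel_curvatureCovKernel hd D) (p, a) (q, b)

/-- `|E_γ[Y_p^a Y_q^b]| ≤ |curvatureTwoPoint p q|`. [folklore] -/
theorem abs_integral_eval_mul_eval_le (hd : 3 ≤ d) (D : ℕ) (p q : ZdPlaquette d) (a b : Fin D) :
    |∫ Y, Y p a * Y q b ∂curvatureGaussianField d D| ≤ |curvatureTwoPoint p q| := by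
  rw [integral_eval_mul_eval_curvatureGaussianField hd]
  split_ifs
  · exact le_rfl
  · rw [abs_zero]; exact abs_nonneg _

/-- The plaquette variables `(p, a) ↦ Y_p^a` are centred under the curvature Gaussian field, in the form the
`GaussianWick` engine consumes. [folklore] -/
theorem integral_evalProcess_curvatureGaussianField (hd : 3 ≤ d) (D : ℕ) :
    ∀ s : ZdPlaquette d × Fin D, ∫ Y, (fun (s : ZdPlaquette d × Fin D) (Y : ZdPlaquette d → Fin D → ℝ) => Y s.1 s.2) s Y
      ∂curvatureGaussianField d D = 0 :=
  fun s => integral_eval_curvatureGaussianField hd D s.1 s.2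

/-- **The centred colour-square composite is `λ/2` times a colour sum of Wick squares**:
`(λ/2)|Y_p|² − (λ/2)·D·C(p,p) = (λ/2) Σ_a ((Y_p^a)² − E_γ[(Y_p^a)²])`. [folklore] -/
theorem centredColourSq_eq_sum_wickSq (hd : 3 ≤ d) (D : ℕ) (lam : ℝ) (p : ZdPlaquette d)
    (Y : ZdPlaquette d → Fin D → ℝ) :
    lam / 2 * (∑ a : Fin D, (Y p a) ^ 2) - lam / 2 * D * curvatureTwoPoint p p =
      lam / 2 * ∑ a : Fin D, (Y p a * Y p a - ∫ Y', Y' p a * Y' p a ∂curvatureGaussianField d D) := by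
  simp only [integral_eval_mul_eval_curvatureGaussianField hd, if_true, Finset.sum_sub_distrib, Finset.sum_const,
    Finset.card_univ, Fintype.card_fin, nsmul_eq_mul, pow_two]
  ring

/-! ### §3 The second cumulant of the Gaussian source: the covariance of two site terms (`d = 4`) -/

/-- **COVARIANCE OF TWO SITE TERMS OF THE GAUSSIAN SOURCE, bounded by two-point numbers.**  With
`A_x = (λ/2)|Y(p₁₂ x)|² − (λ/2) D C(0)`, `X_x = A_x A_{x + n e₀}` (the summand of `gaussIncrement`, mean
`E_γ X_x = (λ²D/2) C(n)²` by `gauss_firstCumulant`) and `C_{uv} = curvatureTwoPoint (p₁₂ u) (p₁₂ v)`: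
`|E_γ[(X_x − E X_x)(X_y − E X_y)]| ≤ (λ/2)⁴ D⁴ · Φ`,
`Φ = 4C_{xy}²C_{x'y'}² + 4C_{xy'}²C_{x'y}² + 16|C_{xy}C_{xy'}C_{x'y}C_{x'y'}| + 16|C_{xx'}C_{yy'}|(|C_{xy}C_{x'y'}| + |C_{xy'}C_{x'y}|)`
(`x' = x + n e₀`, `y' = y + n e₀`): colour by colour the Wick-square covariance `integral_centred_wickSq2_mul`, every term of
which carries at least two propagators between `{x, x'}` and `{y, y'}`. [cite: Janson1997, Thm 1.28] -/
theorem abs_gauss_cov_le (D : ℕ) (lam : ℝ) (n : ℕ) (x y : Site 4) :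
    |∫ Y, ((lam / 2 * (∑ a : Fin D, (Y (plaquette12 (d := 4) (by norm_num) x) a) ^ 2) -
              lam / 2 * D * curvaturePlaquetteCorr (d := 4) (by norm_num) 0) *
            (lam / 2 * (∑ a : Fin D, (Y (plaquette12 (d := 4) (by norm_num) (x + Pi.single (0 : Fin 4) (n : ℤ))) a) ^ 2) -
              lam / 2 * D * curvaturePlaquetteCorr (d := 4) (by norm_num) 0) -
            lam ^ 2 * D / 2 * (curvaturePlaquetteCorr (d := 4) (by norm_num) (n : ℤ)) ^ 2) *
          ((lam / 2 * (∑ a : Fin D, (Y (plaquette12 (d := 4) (by norm_num) y) a) ^ 2) -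
              lam / 2 * D * curvaturePlaquetteCorr (d := 4) (by norm_num) 0) *
            (lam / 2 * (∑ a : Fin D, (Y (plaquette12 (d := 4) (by norm_num) (y + Pi.single (0 : Fin 4) (n : ℤ))) a) ^ 2) -
              lam / 2 * D * curvaturePlaquetteCorr (d := 4) (by norm_num) 0) -
            lam ^ 2 * D / 2 * (curvaturePlaquetteCorr (d := 4) (by norm_num) (n : ℤ)) ^ 2)
        ∂curvatureGaussianField (d := 4) D| ≤
      (lam / 2) ^ 4 * (D : ℝ) ^ 4 *
        (4 * (|curvatureTwoPoint (plaquette12 (d := 4) (by norm_num) x) (plaquette12 (d := 4) (by norm_num) y)| ^ 2 *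
              |curvatureTwoPoint (plaquette12 (d := 4) (by norm_num) (x + Pi.single (0 : Fin 4) (n : ℤ)))
                (plaquette12 (d := 4) (by norm_num) (y + Pi.single (0 : Fin 4) (n : ℤ)))| ^ 2) +
          4 * (|curvatureTwoPoint (plaquette12 (d := 4) (by norm_num) x)
                (plaquette12 (d := 4) (by norm_num) (y + Pi.single (0 : Fin 4) (n : ℤ)))| ^ 2 *
              |curvatureTwoPoint (plaquette12 (d := 4) (by norm_num) (x + Pi.single (0 : Fin 4) (n : ℤ)))
                (plaquette12 (d := 4) (by norm_num) y)| ^ 2) +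
          16 * (|curvatureTwoPoint (plaquette12 (d := 4) (by norm_num) x) (plaquette12 (d := 4) (by norm_num) y)| *
              |curvatureTwoPoint (plaquette12 (d := 4) (by norm_num) x)
                (plaquette12 (d := 4) (by norm_num) (y + Pi.single (0 : Fin 4) (n : ℤ)))| *
              |curvatureTwoPoint (plaquette12 (d := 4) (by norm_num) (x + Pi.single (0 : Fin 4) (n : ℤ)))
                (plaquette12 (d := 4) (by norm_num) y)| *
              |curvatureTwoPoint (plaquette12 (d := 4) (by norm_num) (x + Pi.single (0 : Fin 4) (n : ℤ)))
                (plaquette12 (d := 4) (by norm_num) (y + Pi.single (0 : Fin 4) (n : ℤ)))|) +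
          16 * (|curvatureTwoPoint (plaquette12 (d := 4) (by norm_num) x)
                (plaquette12 (d := 4) (by norm_num) (x + Pi.single (0 : Fin 4) (n : ℤ)))| *
              |curvatureTwoPoint (plaquette12 (d := 4) (by norm_num) y)
                (plaquette12 (d := 4) (by norm_num) (y + Pi.single (0 : Fin 4) (n : ℤ)))|) *
            (|curvatureTwoPoint (plaquette12 (d := 4) (by norm_num) x) (plaquette12 (d := 4) (by norm_num) y)| *
                |curvatureTwoPoint (plaquette12 (d := 4) (by norm_num) (x + Pi.single (0 : Fin 4) (n : ℤ)))
                  (plaquette12 (d := 4) (by norm_num) (y + Pi.single (0 : Fin 4) (n : ℤ)))| +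
              |curvatureTwoPoint (plaquette12 (d := 4) (by norm_num) x)
                  (plaquette12 (d := 4) (by norm_num) (y + Pi.single (0 : Fin 4) (n : ℤ)))| *
                |curvatureTwoPoint (plaquette12 (d := 4) (by norm_num) (x + Pi.single (0 : Fin 4) (n : ℤ)))
                  (plaquette12 (d := 4) (by norm_num) y)|)) := by
  have hd : 3 ≤ 4 := by norm_num
  set γ := curvatureGaussianField (d := 4) D with hγ
  haveI := isProbabilityMeasure_curvatureGaussianField hd D
  set v : Site 4 := Pi.single (0 : Fin 4) (n : ℤ) with hv
  set p1 : ZdPlaquette 4 := plaquette12 (d := 4) hd x with hp1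
  set p2 : ZdPlaquette 4 := plaquette12 (d := 4) hd (x + v) with hp2
  set p3 : ZdPlaquette 4 := plaquette12 (d := 4) hd y with hp3
  set p4 : ZdPlaquette 4 := plaquette12 (d := 4) hd (y + v) with hp4
  set C0 : ℝ := curvaturePlaquetteCorr (d := 4) hd 0 with hC0
  set Cn : ℝ := curvaturePlaquetteCorr (d := 4) hd (n : ℤ) with hCn
  -- the coordinate process and the engine data
  set Xp : (ZdPlaquette 4 × Fin D) → (ZdPlaquette 4 → Fin D → ℝ) → ℝ := fun s Y => Y s.1 s.2 with hXp
  have hX : IsGaussianProcess Xp γ := isGaussianProcess_eval_curvatureGaussianField hd D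
  have h0 : ∀ s, ∫ Y, Xp s Y ∂γ = 0 := integral_evalProcess_curvatureGaussianField hd D
  have hS : ∀ (p q : ZdPlaquette 4) (a b : Fin D),
      ∫ Y, Xp (p, a) Y * Xp (q, b) Y ∂γ = if a = b then curvatureTwoPoint p q else 0 :=
    fun p q a b => integral_eval_mul_eval_curvatureGaussianField hd D p q a b
  have hSabs : ∀ (p q : ZdPlaquette 4) (a b : Fin D),
      |∫ Y, Xp (p, a) Y * Xp (q, b) Y ∂γ| ≤ |curvatureTwoPoint p q| :=
    fun p q a b => abs_integral_eval_mul_eval_le hd D p q a b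
  -- diagonal and shifted two-point numbers
  have hC11 : curvatureTwoPoint p1 p1 = C0 := curvatureTwoPoint_plaquette12_self hd x
  have hC22 : curvatureTwoPoint p2 p2 = C0 := curvatureTwoPoint_plaquette12_self hd (x + v)
  have hC33 : curvatureTwoPoint p3 p3 = C0 := curvatureTwoPoint_plaquette12_self hd y
  have hC44 : curvatureTwoPoint p4 p4 = C0 := curvatureTwoPoint_plaquette12_self hd (y + v)
  have h0f : (⟨0, by omega⟩ : Fin 4) = 0 := rfl
  have hC12 : curvatureTwoPoint p1 p2 = Cn := by
    have h := curvatureTwoPoint_plaquette12_shift hd x (n : ℤ); rw [h0f] at h; exact h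
  have hC34 : curvatureTwoPoint p3 p4 = Cn := by
    have h := curvatureTwoPoint_plaquette12_shift hd y (n : ℤ); rw [h0f] at h; exact h
  -- Wick squares and the centred pair products
  set W : ZdPlaquette 4 × Fin D → (ZdPlaquette 4 → Fin D → ℝ) → ℝ :=
    fun s Y => Xp s Y * Xp s Y - ∫ Y', Xp s Y' * Xp s Y' ∂γ with hW
  set T12 : Fin D × Fin D → (ZdPlaquette 4 → Fin D → ℝ) → ℝ :=
    fun ab Y => W (p1, ab.1) Y * W (p2, ab.2) Y - 2 * (∫ Y', Xp (p1, ab.1) Y' * Xp (p2, ab.2) Y' ∂γ) ^ 2 with hT12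
  set T34 : Fin D × Fin D → (ZdPlaquette 4 → Fin D → ℝ) → ℝ :=
    fun ce Y => W (p3, ce.1) Y * W (p4, ce.2) Y - 2 * (∫ Y', Xp (p3, ce.1) Y' * Xp (p4, ce.2) Y' ∂γ) ^ 2 with hT34
  -- (a) the centred composite as a colour sum of Wick squares
  have hA : ∀ (p : ZdPlaquette 4), curvatureTwoPoint p p = C0 → ∀ Y : ZdPlaquette 4 → Fin D → ℝ,
      lam / 2 * (∑ a : Fin D, (Y p a) ^ 2) - lam / 2 * D * C0 = lam / 2 * ∑ a : Fin D, W (p, a) Y := by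
    intro p hp Y
    rw [← hp, centredColourSq_eq_sum_wickSq hd]
  -- (b) the mean as a colour double sum
  have hmean : ∀ (p q : ZdPlaquette 4), curvatureTwoPoint p q = Cn →
      lam ^ 2 * D / 2 * Cn ^ 2 = (lam / 2) ^ 2 * ∑ ab : Fin D × Fin D, 2 * (∫ Y', Xp (p, ab.1) Y' * Xp (q, ab.2) Y' ∂γ) ^ 2 := by
    intro p q hpq
    simp only [hS, hpq, ite_pow, zero_pow two_ne_zero, mul_ite, mul_zero]
    rw [← Finset.univ_product_univ, Finset.sum_product]
    simp only [Finset.sum_ite_eq, Finset.mem_univ, if_true, Finset.sum_const, Finset.card_univ, Fintype.card_fin,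
      nsmul_eq_mul]
    ring
  have e3 : ∀ u w s : ℝ, lam / 2 * u * (lam / 2 * w) - (lam / 2) ^ 2 * s = (lam / 2) ^ 2 * (u * w - s) :=
    fun u w s => by ring
  -- (c) the centred site terms as colour sums
  have hc12 : ∀ Y : ZdPlaquette 4 → Fin D → ℝ,
      (lam / 2 * (∑ a : Fin D, (Y p1 a) ^ 2) - lam / 2 * D * C0) *
          (lam / 2 * (∑ a : Fin D, (Y p2 a) ^ 2) - lam / 2 * D * C0) - lam ^ 2 * D / 2 * Cn ^ 2 =
        (lam / 2) ^ 2 * ∑ ab : Fin D × Fin D, T12 ab Y := by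
    intro Y
    rw [hA p1 hC11 Y, hA p2 hC22 Y, hmean p1 p2 hC12, e3, Finset.sum_mul_sum, ← Finset.sum_product',
      Finset.univ_product_univ, ← Finset.sum_sub_distrib]
  have hc34 : ∀ Y : ZdPlaquette 4 → Fin D → ℝ,
      (lam / 2 * (∑ a : Fin D, (Y p3 a) ^ 2) - lam / 2 * D * C0) *
          (lam / 2 * (∑ a : Fin D, (Y p4 a) ^ 2) - lam / 2 * D * C0) - lam ^ 2 * D / 2 * Cn ^ 2 =
        (lam / 2) ^ 2 * ∑ ce : Fin D × Fin D, T34 ce Y := by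
    intro Y
    rw [hA p3 hC33 Y, hA p4 hC44 Y, hmean p3 p4 hC34, e3, Finset.sum_mul_sum, ← Finset.sum_product',
      Finset.univ_product_univ, ← Finset.sum_sub_distrib]
  -- (d) colour by colour: the exact Wick-square covariance and its bound by two-point numbers
  set Φ : ℝ := 4 * (|curvatureTwoPoint p1 p3| ^ 2 * |curvatureTwoPoint p2 p4| ^ 2) +
      4 * (|curvatureTwoPoint p1 p4| ^ 2 * |curvatureTwoPoint p2 p3| ^ 2) +
      16 * (|curvatureTwoPoint p1 p3| * |curvatureTwoPoint p1 p4| * |curvatureTwoPoint p2 p3| *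
        |curvatureTwoPoint p2 p4|) +
      16 * (|curvatureTwoPoint p1 p2| * |curvatureTwoPoint p3 p4|) *
        (|curvatureTwoPoint p1 p3| * |curvatureTwoPoint p2 p4| + |curvatureTwoPoint p1 p4| * |curvatureTwoPoint p2 p3|)
    with hΦ
  have hT : ∀ ab ce : Fin D × Fin D, |∫ Y, T12 ab Y * T34 ce Y ∂γ| ≤ Φ := by
    intro ab ce
    have h := integral_centred_wickSq2_mul hX h0 (p1, ab.1) (p2, ab.2) (p3, ce.1) (p4, ce.2)
    simp only [hT12, hT34, hW]
    rw [h, hΦ]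
    exact abs_covForm_le (hSabs _ _ _ _) (hSabs _ _ _ _) (hSabs _ _ _ _) (hSabs _ _ _ _) (hSabs _ _ _ _)
      (hSabs _ _ _ _)
  have iT : ∀ ab ce : Fin D × Fin D, Integrable (fun Y => T12 ab Y * T34 ce Y) γ := by
    intro ab ce
    have h := integrable_centred_wickSq2_mul hX (P := γ) (p1, ab.1) (p2, ab.2) (p3, ce.1) (p4, ce.2)
    simp only [hT12, hT34, hW]
    exact h
  -- (e) the centred product as one colour sum and its integral
  have hprod : ∀ Y : ZdPlaquette 4 → Fin D → ℝ,
      ((lam / 2 * (∑ a : Fin D, (Y p1 a) ^ 2) - lam / 2 * D * C0) *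
            (lam / 2 * (∑ a : Fin D, (Y p2 a) ^ 2) - lam / 2 * D * C0) - lam ^ 2 * D / 2 * Cn ^ 2) *
          ((lam / 2 * (∑ a : Fin D, (Y p3 a) ^ 2) - lam / 2 * D * C0) *
            (lam / 2 * (∑ a : Fin D, (Y p4 a) ^ 2) - lam / 2 * D * C0) - lam ^ 2 * D / 2 * Cn ^ 2) =
        (lam / 2) ^ 4 * ∑ ι : (Fin D × Fin D) × (Fin D × Fin D), T12 ι.1 Y * T34 ι.2 Y := by
    intro Y
    rw [hc12 Y, hc34 Y]
    calc (lam / 2) ^ 2 * (∑ ab : Fin D × Fin D, T12 ab Y) * ((lam / 2) ^ 2 * ∑ ce : Fin D × Fin D, T34 ce Y)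
        = (lam / 2) ^ 4 * ((∑ ab : Fin D × Fin D, T12 ab Y) * (∑ ce : Fin D × Fin D, T34 ce Y)) := by ring
      _ = (lam / 2) ^ 4 * ∑ ι : (Fin D × Fin D) × (Fin D × Fin D), T12 ι.1 Y * T34 ι.2 Y := by
        rw [Finset.sum_mul_sum, ← Finset.sum_product', Finset.univ_product_univ]
  have hint : ∫ Y, ((lam / 2 * (∑ a : Fin D, (Y p1 a) ^ 2) - lam / 2 * D * C0) *
            (lam / 2 * (∑ a : Fin D, (Y p2 a) ^ 2) - lam / 2 * D * C0) - lam ^ 2 * D / 2 * Cn ^ 2) *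
          ((lam / 2 * (∑ a : Fin D, (Y p3 a) ^ 2) - lam / 2 * D * C0) *
            (lam / 2 * (∑ a : Fin D, (Y p4 a) ^ 2) - lam / 2 * D * C0) - lam ^ 2 * D / 2 * Cn ^ 2) ∂γ =
      (lam / 2) ^ 4 * ∑ ι : (Fin D × Fin D) × (Fin D × Fin D), ∫ Y, T12 ι.1 Y * T34 ι.2 Y ∂γ := by
    rw [integral_congr_ae (ae_of_all _ hprod), integral_const_mul, integral_finsetSum _ (fun ι _ => iT ι.1 ι.2)]
  -- (f) conclusion
  have hl : 0 ≤ (lam / 2) ^ 4 := by positivity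
  rw [hint, abs_mul, abs_of_nonneg hl, mul_assoc]
  refine mul_le_mul_of_nonneg_left ?_ hl
  calc |∑ ι : (Fin D × Fin D) × (Fin D × Fin D), ∫ Y, T12 ι.1 Y * T34 ι.2 Y ∂γ|
      ≤ ∑ ι : (Fin D × Fin D) × (Fin D × Fin D), |∫ Y, T12 ι.1 Y * T34 ι.2 Y ∂γ| := Finset.abs_sum_le_sum_abs _ _
    _ ≤ ∑ _ι : (Fin D × Fin D) × (Fin D × Fin D), Φ := Finset.sum_le_sum fun ι _ => hT ι.1 ι.2
    _ = (D : ℝ) ^ 4 * Φ := by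
      rw [Finset.sum_const, Finset.card_univ, Fintype.card_prod, Fintype.card_prod, Fintype.card_fin, nsmul_eq_mul]
      push_cast
      ring

end Curvature

end Summit.QuantumFields.YangMills.Cruxes.SourcedPressureIncrement.Birth
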